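import Mathlib
import HarnessLib
import Summits.NavierStokesRegularity.NavierStokesRegularity.Theorems.PoloidalWindowDoorLrcModEntireQ4TimeWebPackage
import Summits.NavierStokesRegularity.NavierStokesRegularity.Theorems.PoloidalWindowDoorLrcModEntireSonicWebsParallelWindow

/-!
# Route `PoloidalWindowDoor`, item `LrcModEntire` (stmt-NavierStokesRegularity-20428), cell (Q4-sonic, straight, μ < 0) `stub_Q4sonicLineNeg`, case I —
# THE ENTRANCE OF THE ASSEMBLY A-I: ONE BOX CARRYING THE WEB PACKAGE, THE SONIC LITERAL, PARALLEL WEBS AND A NEGATIVE SLOPE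

Cell ns-regularity-ideate, stub-worker seat ns-poloidal-K2-p2 g17 under the LEAD of item 20428 (ns-poloidal-K2-p3 g17; T2B-g17 §7/§9, `CASE-I-SPLIT-v14.md`);
`--supports stmt-NavierStokesRegularity-20428 --as helper`.  Bookkeeping only: from the hypotheses of port-2's `…Q4TimeWebPackage.time_web_package_line` (= the
binders of `stub_Q4sonicLineNeg` after `F := σ·U₂(−1+·,·)`), the (v11) literal `μ(−1,0) ≠ 0`, and the CASE-I literal of the v14 child
(`∃ δ″ > 0, ∀ τ, |τ| < δ″ → R(τ,·)` affine on `|z| < δ`), produce ONE window `δ* > 0` (`δ* ≤ ρ`, `δ* < 1/2`) on which: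
the package block `hpack` of `time_web_package_line` (web function `n₀`, ridge curvature `κ`, frame vector `e = Γ′(0)` horizontal unit), the sonic literal at every
`|τ| < δ*` on `|z| < δ*`, PARALLEL WEBS on the box (K2-p2 g16's B-T `…SonicWebsParallelWindow.sonic_webs_parallel_timeWeb_box`) and `μ(−1+τ, z) < 0` on the box.

* `slope_neg_of_package` — `μ(−1,0) < 0`: the Huygens identity of the package at `(0,0,0)` with `R_zz(0,0) = 0` gives `κ·n_z² = −μκ(1 + n_s²)`, so `μ(−1,0) ≤ 0`,
  and `μ(−1,0) ≠ 0` is the (v11) literal;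
* ★ `caseI_entrance` — the box, exactly in the hypothesis currency of `…SonicSheetStrainWindow.sheet_strain_window`, `…SheetCauchyDataPeriodic` and port-2's
  `…CaseISfreeBranch.caseI_sfree_false` (`hpack`, `hsonB`/`hsonI`, `hparN`/`hparI`, `hμnegB`, `hδ'ρ`, `hδ'h`, `he2`, `hunit`).

WHAT THIS IS NOT: not a claim about Navier–Stokes regularity and not a stub of the registry — entrance bookkeeping for the case-I chain of the research slot
`stub_Q4sonicLineNeg` (registry twist_split v13); no stub is closed here; items 20428 / 19708 / 27893 OPEN (bears_on LADDER-NS N0).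
-/

noncomputable section

set_option linter.dupNamespace false
set_option linter.style.longLine false

namespace Summit.NavierStokesRegularity.NavierStokesRegularity.Theorems.PoloidalWindowDoorLrcModEntireCaseIEntrance

open Set Function Filter Topology Metric
open scoped RealInnerProductSpace InnerProductSpace ContDiff
open Literature.Analysis Literature.Analysis.FluidPDE Literature.Analysis.UnboundedOperators
open Summit.NavierStokesRegularity.NavierStokesRegularity.Theorems
open Summit.NavierStokesRegularity.NavierStokesRegularity.Theorems.PoloidalWindowDoorLrcModEntireSheetFlattenTools
open Summit.NavierStokesRegularity.NavierStokesRegularity.Theorems.PoloidalWindowDoorLrcModEntireQ4TimeWebPackage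
open Summit.NavierStokesRegularity.NavierStokesRegularity.Theorems.PoloidalWindowDoorLrcModEntireSonicWebsParallelWindow

variable {C : ℝ} {U : ℝ → EuclideanSpace ℝ (Fin 3) → EuclideanSpace ℝ (Fin 3)} {Γ νΓ : ℝ → EuclideanSpace ℝ (Fin 3)} {R μ : ℝ → ℝ → ℝ}
  {σ κ r δ ρ : ℝ}

/-- **The slope is negative at the hot spot.**  From the package block at `(0,0,0)` (Huygens identity, `κ(0,0) > 0`, smooth `n₀`), the (v9) literal `R(0,·)`
affine on `|z| < δ′` and the (v11) literal `μ(−1,0) ≠ 0`: `μ(−1,0) < 0`. -/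
theorem slope_neg_of_package {δ' : ℝ} {e : EuclideanSpace ℝ (Fin 3)} {n₀ : ℝ × ℝ × ℝ → ℝ} {κt : ℝ → ℝ → ℝ} (hδ' : 0 < δ')
    (hpack : ∀ q : ℝ × ℝ × ℝ, |q.1| < δ' → |q.2.2| < δ' →
        n₀ q ∈ Ioo (-r) r ∧
        σ * U (-1 + q.1) (frameCLM e (q.2.1, n₀ q, q.2.2)) 2 = R q.1 q.2.2 ∧
        (∀ n ∈ Icc (-r) r, n ≠ n₀ q → σ * U (-1 + q.1) (frameCLM e (q.2.1, n, q.2.2)) 2 < R q.1 q.2.2) ∧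
        (∀ w : EuclideanSpace ℝ (Fin 3), w 2 = 0 → fderiv ℝ (fun y => U (-1 + q.1) y 2) (frameCLM e (q.2.1, n₀ q, q.2.2)) w = 0) ∧
        (∀ m : ℕ∞, ContDiffAt ℝ m n₀ q) ∧
        0 < κt q.1 q.2.2 ∧
        fderiv ℝ (fderiv ℝ (fun y => σ * U (-1 + q.1) y 2)) (frameCLM e (q.2.1, n₀ q, q.2.2)) e e +
            fderiv ℝ (fderiv ℝ (fun y => σ * U (-1 + q.1) y 2)) (frameCLM e (q.2.1, n₀ q, q.2.2)) (Jvec e) (Jvec e) =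
          -κt q.1 q.2.2 ∧
        κt q.1 q.2.2 * (fderiv ℝ n₀ q ((0 : ℝ), (0 : ℝ), (1 : ℝ))) ^ 2 =
          (deriv (deriv (R q.1)) q.2.2 - μ (-1 + q.1) q.2.2 * κt q.1 q.2.2) * (1 + (fderiv ℝ n₀ q ((0 : ℝ), (1 : ℝ), (0 : ℝ))) ^ 2))
    (hson0 : ∃ A B : ℝ, ∀ z : ℝ, |z| < δ' → R 0 z = A + B * z) (hμne : ¬ (μ (-1) 0 = 0)) : μ (-1) 0 < 0 := by
  have h0 : |(0 : ℝ)| < δ' := by simpa using hδ'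
  obtain ⟨-, -, -, -, -, hκ, -, hH⟩ := hpack ((0 : ℝ), (0 : ℝ), (0 : ℝ)) h0 h0
  simp only at hκ hH
  -- `R_zz(0,0) = 0`
  obtain ⟨A, B, hAB⟩ := hson0
  have hI : IsOpen (Ioo (-δ') δ') := isOpen_Ioo
  have hRev : (R 0) =ᶠ[𝓝 (0 : ℝ)] fun w => A + B * w := by
    filter_upwards [hI.mem_nhds (show (0 : ℝ) ∈ Ioo (-δ') δ' from ⟨by linarith, hδ'⟩)] with w hw
    exact hAB w (abs_lt.2 ⟨by linarith [hw.1], hw.2⟩)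
  have hR'' : deriv (deriv (R 0)) 0 = 0 := by
    have hev1 : deriv (R 0) =ᶠ[𝓝 (0 : ℝ)] fun _ => B := by
      filter_upwards [hRev.eventuallyEq_nhds] with w hw
      have hdAB : HasDerivAt (fun v : ℝ => A + B * v) B w := by
        simpa using ((hasDerivAt_id w).const_mul B).const_add A
      rw [hw.deriv_eq, hdAB.deriv]
    rw [hev1.deriv_eq, deriv_const]
  rw [hR'', zero_sub] at hH
  have hsimp : (-1 : ℝ) + 0 = -1 := by norm_num
  rw [hsimp] at hH
  -- `κ n_z² = −μ κ (1 + n_s²)` ⇒ `μ ≤ 0`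
  have hle : μ (-1) 0 ≤ 0 := by
    by_contra hpos
    push Not at hpos
    have h1 : 0 ≤ κt 0 0 * fderiv ℝ n₀ (0, 0, 0) (0, 0, 1) ^ 2 := by positivity
    have h2 : 0 < μ (-1) 0 * κt 0 0 * (1 + fderiv ℝ n₀ (0, 0, 0) (0, 1, 0) ^ 2) := by positivity
    nlinarith [hH, h1, h2]
  exact lt_of_le_of_ne hle hμne

/-- ★ **THE ENTRANCE BOX OF CASE I.**  Hypotheses = those of `…Q4TimeWebPackage.time_web_package_line` (class profile `U`, signed hot value, straight hot branch
`Γ` with normal `νΓ`, ridge curvature `κ`, tube radius `r`, window `δ`, strict concavity, the web Fermat law, the (TH) slab law with `C³` slope on `|t+1|, |x₂| < ρ`)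
plus the (v11) literal `μ(−1,0) ≠ 0` and the CASE-I literal of the v14 child.  Conclusion: a window `δ*` with `0 < δ* ≤ ρ`, `δ* < 1/2`, the frame vector
`e = Γ′(0)` horizontal unit, a web function `n₀` and a ridge curvature `κt` such that on the box `|τ|, |z| < δ*`: the package block (verbatim shape of
`time_web_package_line`), the sonic literal at every `τ`, parallel webs `n₀(τ,s,z) = n₀(τ,0,z)`, and `μ(−1+τ,z) < 0`. -/
theorem caseI_entrance
    (hUrate : HasTypeITimeDecay C U) (hUcont : ContinuousOn (uncurry U) (Iio (0 : ℝ) ×ˢ univ))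
    (hUmild : ∀ s t : ℝ, s < t → t < 0 → ∀ x, U t x = heatExtension (U s) (t - s) x - oseenDuhamel 1 s U U t x)
    (hUdiv : ∀ t < 0, VectorCalculus.IsDivFree (U t))
    (hUpol : ∀ s < 0, ∀ q, ⟪curl (U s) q, EuclideanSpace.single 2 1⟫_ℝ = 0)
    (hUne : U (-1) 0 2 ≠ 0) (hUhotbd : ∀ t < 0, ∀ x, Real.sqrt (-t) * |U t x 2| ≤ |U (-1) 0 2|)
    (hσ : σ = 1 ∨ σ = -1) (hσN : σ * U (-1) 0 2 = |U (-1) 0 2|) (hκ : 0 < κ)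
    (hΓ0 : Γ 0 = 0) (hΓ2 : ∀ s, Γ s 2 = 0) (hΓunit : ∀ s, ‖deriv Γ s‖ = 1) (hΓhot : ∀ s, U (-1) (Γ s) 2 = U (-1) 0 2)
    (hν : ∀ s, νΓ s = WithLp.toLp 2 ![-(deriv Γ s 1), deriv Γ s 0, 0])
    (hΓcurv : ∀ s, κ ≤ -(fderiv ℝ (fderiv ℝ (fun y => σ * U (-1) y 2)) (Γ s) (νΓ s) (νΓ s)))
    (hr : 0 < r) (hδ : 0 < δ)
    (hconc : ∀ τ z : ℝ, |τ| < δ → |z| < δ → ∀ s : ℝ, ∀ n ∈ Ioo (-r) r,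
      fderiv ℝ (fderiv ℝ (fun y => σ * U (-1 + τ) y 2)) (Γ s + n • νΓ s + z • EuclideanSpace.single 2 (1 : ℝ)) (νΓ s) (νΓ s) < 0)
    (hweb : ∀ τ₀ z₀ : ℝ, |τ₀| < δ → |z₀| < δ → ∀ s₀ : ℝ, ∃ n₀ ∈ Ioo (-r) r,
      σ * U (-1 + τ₀) (Γ s₀ + n₀ • νΓ s₀ + z₀ • EuclideanSpace.single 2 (1 : ℝ)) 2 = R τ₀ z₀ ∧
      (∀ n ∈ Icc (-r) r, n ≠ n₀ → σ * U (-1 + τ₀) (Γ s₀ + n • νΓ s₀ + z₀ • EuclideanSpace.single 2 (1 : ℝ)) 2 < R τ₀ z₀) ∧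
      DifferentiableAt ℝ (uncurry R) (τ₀, z₀) ∧
      fderiv ℝ (uncurry fun τ y => σ * U (-1 + τ) y 2) (τ₀, Γ s₀ + n₀ • νΓ s₀ + z₀ • EuclideanSpace.single 2 (1 : ℝ)) =
        (fderiv ℝ (uncurry R) (τ₀, z₀)).comp
          ((ContinuousLinearMap.fst ℝ ℝ (EuclideanSpace ℝ (Fin 3))).prod
            ((EuclideanSpace.proj (2 : Fin 3)).comp (ContinuousLinearMap.snd ℝ ℝ (EuclideanSpace ℝ (Fin 3))))))
    (hρ : 0 < ρ) (hμ3 : ContDiff ℝ 3 (uncurry μ))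
    (hslabU : ∀ t : ℝ, |t + 1| < ρ → ∀ x : EuclideanSpace ℝ (Fin 3), |x 2| < ρ → ∀ b : Fin 3, b ≠ 2 →
      fderiv ℝ (U t) x (EuclideanSpace.single 2 1) b = μ t (x 2) * fderiv ℝ (U t) x (EuclideanSpace.single b 1) 2)
    (hevU : ∀ t₀ : ℝ, |t₀ + 1| < ρ → ∀ y₀ : EuclideanSpace ℝ (Fin 3), y₀ 2 = 0 →
      ∀ᶠ z in 𝓝 ((t₀, y₀) : ℝ × EuclideanSpace ℝ (Fin 3)), ∀ b : Fin 3, b ≠ 2 →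
        fderiv ℝ (U z.1) z.2 (EuclideanSpace.single 2 1) b = μ z.1 (z.2 2) * fderiv ℝ (U z.1) z.2 (EuclideanSpace.single b 1) 2)
    (hline : ∀ s : ℝ, Γ s = s • deriv Γ 0) (hμne : ¬ (μ (-1) 0 = 0))
    (hcaseI : ∃ δ'' : ℝ, 0 < δ'' ∧ ∀ τ : ℝ, |τ| < δ'' → ∃ a b : ℝ, ∀ z : ℝ, |z| < δ → R τ z = a + b * z) :
    ∃ (δs : ℝ) (n₀ : ℝ × ℝ × ℝ → ℝ) (κt : ℝ → ℝ → ℝ), 0 < δs ∧ δs ≤ ρ ∧ δs < 1 / 2 ∧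
      deriv Γ 0 2 = 0 ∧ deriv Γ 0 0 ^ 2 + deriv Γ 0 1 ^ 2 = 1 ∧
      (∀ q : ℝ × ℝ × ℝ, |q.1| < δs → |q.2.2| < δs →
        n₀ q ∈ Ioo (-r) r ∧
        σ * U (-1 + q.1) (frameCLM (deriv Γ 0) (q.2.1, n₀ q, q.2.2)) 2 = R q.1 q.2.2 ∧
        (∀ n ∈ Icc (-r) r, n ≠ n₀ q → σ * U (-1 + q.1) (frameCLM (deriv Γ 0) (q.2.1, n, q.2.2)) 2 < R q.1 q.2.2) ∧
        (∀ w : EuclideanSpace ℝ (Fin 3), w 2 = 0 → fderiv ℝ (fun y => U (-1 + q.1) y 2) (frameCLM (deriv Γ 0) (q.2.1, n₀ q, q.2.2)) w = 0) ∧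
        (∀ m : ℕ∞, ContDiffAt ℝ m n₀ q) ∧
        0 < κt q.1 q.2.2 ∧
        fderiv ℝ (fderiv ℝ (fun y => σ * U (-1 + q.1) y 2)) (frameCLM (deriv Γ 0) (q.2.1, n₀ q, q.2.2)) (deriv Γ 0) (deriv Γ 0) +
            fderiv ℝ (fderiv ℝ (fun y => σ * U (-1 + q.1) y 2)) (frameCLM (deriv Γ 0) (q.2.1, n₀ q, q.2.2)) (Jvec (deriv Γ 0)) (Jvec (deriv Γ 0)) =
          -κt q.1 q.2.2 ∧
        κt q.1 q.2.2 * (fderiv ℝ n₀ q ((0 : ℝ), (0 : ℝ), (1 : ℝ))) ^ 2 =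
          (deriv (deriv (R q.1)) q.2.2 - μ (-1 + q.1) q.2.2 * κt q.1 q.2.2) * (1 + (fderiv ℝ n₀ q ((0 : ℝ), (1 : ℝ), (0 : ℝ))) ^ 2)) ∧
      (∀ τ : ℝ, |τ| < δs → ∃ A B : ℝ, ∀ z : ℝ, |z| < δs → R τ z = A + B * z) ∧
      (∀ τ s z : ℝ, |τ| < δs → |z| < δs → n₀ (τ, s, z) = n₀ (τ, (0 : ℝ), z)) ∧
      (∀ τ z : ℝ, |τ| < δs → |z| < δs → μ (-1 + τ) z < 0) := by
  -- the space–time web package on `δ′`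
  obtain ⟨δ', n₀, κt, hδ'pos, hδ'δ, hδ'ρ, hδ'h, he2, hunit, hpack, -⟩ :=
    time_web_package_line hUrate hUcont hUmild hUdiv hUpol hUne hUhotbd hσ hσN hκ hΓ0 hΓ2 hΓunit hΓhot hν hΓcurv hr hδ hconc hweb hρ hμ3 hslabU hevU hline
  obtain ⟨δ'', hδ''pos, hsonI⟩ := hcaseI
  -- the slope is negative at the hot spot
  have hson0 : ∃ A B : ℝ, ∀ z : ℝ, |z| < δ' → R 0 z = A + B * z := by
    obtain ⟨a, b, hab⟩ := hsonI 0 (by simpa using hδ''pos)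
    exact ⟨a, b, fun z hz => hab z (lt_of_lt_of_le hz hδ'δ)⟩
  have hμneg : μ (-1) 0 < 0 := slope_neg_of_package (U := U) (R := R) (μ := μ) hδ'pos hpack hson0 hμne
  -- parallel webs on a box (K2-p2 g16's B-T)
  obtain ⟨δ₃, hδ₃pos, hδ₃δ', -, hparB⟩ := sonic_webs_parallel_timeWeb_box (n₀ := n₀) hUrate hUcont hUmild hUdiv hUpol hσ hΓ2 hΓunit hν hline hδ hconc hweb hρ
    hμ3 hslabU hμneg hδ''pos hsonI hδ'pos (fun τ s z hτ hz => ⟨(hpack (τ, s, z) hτ hz).1, (hpack (τ, s, z) hτ hz).2.1⟩)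
  -- `μ(−1+τ, z) < 0` near `(0,0)` (continuity of the slope)
  have hμc : Continuous fun p : ℝ × ℝ => μ (-1 + p.1) p.2 := by
    have : (fun p : ℝ × ℝ => μ (-1 + p.1) p.2) = uncurry μ ∘ fun p : ℝ × ℝ => ((-1 + p.1, p.2) : ℝ × ℝ) := by funext p; rfl
    rw [this]; exact hμ3.continuous.comp ((continuous_const.add continuous_fst).prodMk continuous_snd)
  have h00 : μ (-1 + (0 : ℝ × ℝ).1) (0 : ℝ × ℝ).2 < 0 := by simpa using hμneg
  obtain ⟨ε, hε, hεμ⟩ : ∃ ε > 0, ∀ p : ℝ × ℝ, dist p 0 < ε → μ (-1 + p.1) p.2 < 0 :=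
    Metric.eventually_nhds_iff.1 (hμc.continuousAt.eventually (gt_mem_nhds h00))
  -- the common box
  set δs : ℝ := min (min δ₃ δ'') ε with hδs
  have hδspos : 0 < δs := lt_min (lt_min hδ₃pos hδ''pos) hε
  have h1 : δs ≤ δ₃ := (min_le_left _ _).trans (min_le_left _ _)
  have h2 : δs ≤ δ'' := (min_le_left _ _).trans (min_le_right _ _)
  have h3 : δs ≤ ε := min_le_right _ _
  have h4 : δs ≤ δ' := h1.trans hδ₃δ'
  refine ⟨δs, n₀, κt, hδspos, h4.trans hδ'ρ, lt_of_le_of_lt h4 hδ'h, he2, hunit, fun q hq1 hq2 => hpack q (lt_of_lt_of_le hq1 h4) (lt_of_lt_of_le hq2 h4),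
    fun τ hτ => ?_, fun τ s z hτ hz => hparB τ s z (lt_of_lt_of_le hτ h1) (lt_of_lt_of_le hz h1), fun τ z hτ hz => ?_⟩
  · obtain ⟨a, b, hab⟩ := hsonI τ (lt_of_lt_of_le hτ h2)
    exact ⟨a, b, fun z hz => hab z (lt_of_lt_of_le (lt_of_lt_of_le hz h4) hδ'δ)⟩
  · have hd : dist ((τ, z) : ℝ × ℝ) 0 < ε := by
      rw [dist_zero_right, Prod.norm_def]
      exact max_lt (by simpa [Real.norm_eq_abs] using lt_of_lt_of_le hτ h3) (by simpa [Real.norm_eq_abs] using lt_of_lt_of_le hz h3)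
    exact hεμ (τ, z) hd

end Summit.NavierStokesRegularity.NavierStokesRegularity.Theorems.PoloidalWindowDoorLrcModEntireCaseIEntrance

end
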